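import Summits.QuantumFields.BalabanUV.T4Continuum.Support.B13Base

/-!
# InsertionLinearClassLoc — the linear insertion class with PER-READ-OUT (localized) budgets: W3 (`InsScaleBound`), the history
# budgets of leaf L03 ∕ `BaseBudget` and W4 (`InsertionRate`) from age ∕ total ∕ rate budgets taken ALONG A NORMING FAMILY OF
# READ-OUTS of the history space instead of in global weighted ℓ¹ sums — so that on the history space of record (a weighted SUP norm)
# the constants `c`, `V`, `δv` are LOCAL, i.e. volume-uniform
# (cell `pub-balaban`, T⁴ fan-out, `HOME/BINDER-OWNERS.md` row NE5, owner lineage t4-ne5-p1, gen 30; ruling R22)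

HONEST FRAMING (T4-DAG PAGE 1).  Rung (B)+1 on ONE finite four-torus of fixed physical size — NOT infinite volume, NOT a mass gap, NOT
the Clay problem; `FlowStep.BetaPertH`, (B), (B^μ) do not occur here.  NE5 (`T4OutputRate.NE5`) is NOT PRINTED and NOT PROVED (spine
0/9, unchanged).  Nothing of Bałaban's series is asserted; 0 cite tags.  Printed KIND (quoted verbatim in the leaf `T4InputCauchyRateData`
§11 and the lineage's loci sheet): [II] = [Balaban1988RG2Cluster] p. 7–9, (1.22)–(1.24) and Lemma 1 (1.33)–(1.36) — the earlier actions
are localized DOMAIN BY DOMAIN and the (1.36) bound on the inserted potential `𝐕″_k(Y, ·)` AT A DOMAIN `Y` sums the contributions of the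
earlier domains INSIDE `Y` with the age factors `(Lʲη)`: a bound PER ENTRY of the potential table, uniform in `Y` and in the volume.
HONEST DEPENDENCY (cell, verbatim): continuum YM on T⁴ ⇐ BetaPertH ∧ nine spine estimates (0/9 proved); BetaPertH ⇐ (D1) ∧ (D4) ∧
CAP+tail; G-an2-4 gates asym, D1 and NE2/3/4.

WHY (owner finding, gen 30; ruling R22 — the W3 ∕ base-budget ∕ W4 analogue of R21).  The linear-class reductions in the tree —
`InsertionLinearClass.AgeBudget` (W3: `Σ_{Y ∈ dom k, scale Y = j} e^{−κd(Y)}‖vec Y‖ ≤ rHist·c·ω^{k−1−j}`), `B13Base.VecBudget` (the total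
feeding `HistBudgetB`/`HistBudgetA`/`InBase`) and `InsertionLinearRate.VecRate` (W4's vector rate) — bound `‖Σ_Y t(Y)•vec Y‖` by the
triangle inequality in `Hist`, so their left-hand sides are weighted ℓ¹ sums over ALL earlier domains read at step `k`.  On the history
space of record `B13HistDatum.Hist F` (bounded tables with the WEIGHTED SUP norm) the insertion vector of an earlier domain `Y′` is
supported on the entries of the domains NEAR `Y′`, and `‖Σ_{Y′} t(Y′)•vec Y′‖_sup = sup_entry |Σ_{Y′} t(Y′)·(vec Y′)(entry)|` is a
LOCAL sum — while `Σ_{Y′}‖vec Y′‖_sup` grows like the NUMBER of earlier domains, i.e. like the volume: the displayed `c` (which enters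
the smallness S `ω + Λc < θ′` and the reach R) would be volume-extensive.  REMEDY (this module): take every budget ALONG A NORMING FAMILY
`ρ : E → (Hist →L[ℂ] ℂ)` of read-outs (`Norming ρ`: `‖h‖ ≤ μ` as soon as `‖ρ e h‖ ≤ μ` for every `e`, `μ ≥ 0`; for `Hist F` the point
evaluations, `norming_evalCLM`) — `AgeBudgetLoc`, `VecBudgetLoc`, `VecRateLoc` bound `Σ_Y e^{−κd(Y)}‖ρ e (vec Y)‖` FOR EACH `e` — and
re-prove the four consumers with `‖·‖ ≤ μ ⇐ ∀ e, ‖ρ e ·‖ ≤ μ` in place of the triangle inequality.  The global shapes are the case of a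
norming family of norm ≤ 1 read-outs only in the sense `global ⟹ local` (bridges below); the converse is unavailable — that is the point.

WHAT THIS MODULE IS (all conclusions are the tree's shapes BY NAME; no END face is restated — they consume these conclusions unchanged):
* §1 `Norming ρ`, `norm_sum_smul_le_of_norming` (the localized triangle inequality), `norming_evalCLM` (point evaluations norm every
  space of bounded functions `α →ᵇ ℂ` — the history space of record is one), `norm_evalCLM_apply_le`.
* §2 shapes `AgeBudgetLoc L M W κ c ω ρ`, `VecBudgetLoc L W κ V ρ`, `VecRateLoc LA LB M W κ δv θ ρ` + bridges `ageBudgetLoc_of_ageBudget`,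
  `vecBudgetLoc_of_vecBudget`, `vecRateLoc_of_vecRate` (read-outs of norm ≤ 1).
* §3 W3: `insScaleBoundLevel_of_ageBudgetLoc`, `insScaleBound_of_ageBudgetLoc`, `insertion_binders_of_reads_loc` (⟹ `StepModel.InsScaleBound`
  etc. BY NAME); the total: `vecBudgetLoc_of_ageBudgetLoc`; the (1.36) mechanism: `norm_ins_sub_base_le_of_vecBudgetLoc`,
  `histBudgetB_of_linearLoc`, `histBudgetA_of_linearLoc`, `inBase_of_linearLoc`, `inBase_baseBudget_of_selfCtr_ageBudgetLoc` (leaf L03 +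
  `BaseBudget` for the self-centred installed model from run B's LOCAL age budget); W4: `insertionRate_of_linearLoc`.

STATUS (census, Edison rule).  Bookkeeping/[folklore]; discharges NO wall; changes NO census value except the READING of `c` (W3), of the
history budget (L03/R) and of `δv` (W4): per read-out, volume-uniform on the Hist of record.  NE5 NOT PROVED; 0/12 leaves on Bałaban's
concrete objects; spine 0/9; rung (B)+1 finite T⁴; NOT infinite volume / mass gap / Clay.  0 sorry; axioms ⊆ {propext, Classical.choice,
Quot.sound}.
-/

noncomputable section

open scoped BigOperators
open Finset Set Metric

namespace Summit.QuantumFields.BalabanUV.T4Continuum.InsertionLinearClassLoc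

open Literature.MathematicalPhysics.QuantumFieldTheory.Balaban1983to89.T4OutputRate (Carriers Functional DecayBound)
open Literature.MathematicalPhysics.QuantumFieldTheory.Balaban1983to89.T4InputCauchyRateData (StepModel tableA tableB)
open Literature.MathematicalPhysics.QuantumFieldTheory.Balaban1983to89.T4InputCauchyRateSpecies
  (ballClass BaseBudget BoxInClass boxInClass_of_baseBudget)
open Literature.MathematicalPhysics.QuantumFieldTheory.Balaban1983to89.T4InputCauchyRateSecant (HistBudgetA)
open Summit.QuantumFields.BalabanUV.T4Continuum.InsertionLinearClass (LinearInsertion)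
open Summit.QuantumFields.BalabanUV.T4Continuum.InsertionLinearClass.LinearInsertion (Reads AgeBudget)
open Summit.QuantumFields.BalabanUV.T4Continuum.InsertionLinearRate.LinearPair (ReadsB BaseRate VecRate)
open Summit.QuantumFields.BalabanUV.T4Continuum.B13Base

/-! ## §1 Norming families of read-outs -/

section Norming

variable {Hist : Type*} [NormedAddCommGroup Hist] [NormedSpace ℂ Hist] {E : Type*}

/-- HYPOTHESIS SHAPE `Norming ρ` (bookkeeping about the NORM of the history space, no estimate of the series): the family of continuous
linear read-outs `ρ e : Hist →L[ℂ] ℂ` norms the space from above — if every read-out of `h` has modulus `≤ μ` (`μ ≥ 0`), then `‖h‖ ≤ μ`.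
The history space of record (bounded tables, weighted sup norm) is normed by its point evaluations (`norming_evalCLM`). [folklore] -/
def Norming (ρ : E → (Hist →L[ℂ] ℂ)) : Prop :=
  ∀ (h : Hist) (μ : ℝ), 0 ≤ μ → (∀ e, ‖ρ e h‖ ≤ μ) → ‖h‖ ≤ μ

/-- **THE LOCALIZED TRIANGLE INEQUALITY**: along a norming family, a real-weighted finite combination of vectors has norm at most `B`
as soon as, FOR EACH read-out `e`, `Σ_a |c a|·‖ρ e (v a)‖ ≤ B` (`B ≥ 0`). [folklore] -/
theorem norm_sum_smul_le_of_norming {ρ : E → (Hist →L[ℂ] ℂ)} (hρ : Norming ρ) {α : Type*} {s : Finset α} {c : α → ℝ}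
    {v : α → Hist} {B : ℝ} (hB : 0 ≤ B) (h : ∀ e, ∑ a ∈ s, |c a| * ‖ρ e (v a)‖ ≤ B) :
    ‖∑ a ∈ s, ((c a : ℝ) : ℂ) • v a‖ ≤ B := by
  refine hρ _ B hB fun e => ?_
  rw [map_sum]
  refine (norm_sum_le _ _).trans (le_trans (Finset.sum_le_sum fun a _ => ?_) (h e))
  rw [map_smul, norm_smul, Complex.norm_real, Real.norm_eq_abs]

/-- **POINT EVALUATIONS NORM EVERY SPACE OF BOUNDED FUNCTIONS** `α →ᵇ ℂ` (Mathlib's `BoundedContinuousFunction.norm_le`) — in particular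
the history space of record `B13HistDatum.Hist F = Entry F →ᵇ ℂ`. [folklore] -/
theorem norming_evalCLM {α : Type*} [TopologicalSpace α] :
    Norming (Hist := BoundedContinuousFunction α ℂ) fun a : α => BoundedContinuousFunction.evalCLM ℂ a :=
  fun h μ hμ hh => (BoundedContinuousFunction.norm_le hμ).2 fun a => by
    simpa only [BoundedContinuousFunction.evalCLM_apply] using hh a

/-- Point evaluations do not increase the norm (`‖h a‖ ≤ ‖h‖`) — the hypothesis of the bridges of §2 for the Hist of record. [folklore] -/
theorem norm_evalCLM_apply_le {α : Type*} [TopologicalSpace α] (a : α) (h : BoundedContinuousFunction α ℂ) :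
    ‖BoundedContinuousFunction.evalCLM ℂ a h‖ ≤ ‖h‖ := by
  rw [BoundedContinuousFunction.evalCLM_apply]
  exact h.norm_coe_le_norm a

end Norming

variable {C : Carriers} {Op Hist : Type*} [NormedAddCommGroup Op] [NormedSpace ℂ Op] [NormedAddCommGroup Hist]
  [NormedSpace ℂ Hist] {E : Type*}

/-! ## §2 The per-read-out budget shapes and the bridges from the global ones -/

section Shapes

/-- HYPOTHESIS SHAPE `AgeBudgetLoc L M W κ c ω ρ` — W3 in vector form PER READ-OUT (`InsertionLinearClass.AgeBudget` with `‖vec Y‖` replaced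
by `‖ρ e (vec Y)‖`, for every read-out `e`; printed KIND: the age bookkeeping `(Lʲη)`-factors of [II] p. 8 ∕ (1.24), which bound the
contribution of the scale-`j` earlier domains to ONE entry of the potential table; NOT PRINTED as a statement about insertion vectors):
for every read-out `e`, the `e^{−κd}`-weighted sum over the scale-`j` earlier domains of `‖ρ e (vec g U k Y)‖` is at most `rHist k·c·ω^{k−1−j}`.
[folklore] -/
def AgeBudgetLoc (L : LinearInsertion C Hist) (M : StepModel C Op Hist) (W : Set (ℕ → ℝ)) (κ c ω : ℝ)
    (ρ : E → (Hist →L[ℂ] ℂ)) : Prop :=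
  ∀ k, ∀ g ∈ W, ∀ (U : C.BgB) (j : ℕ), j < k → ∀ e : E,
    ∑ Y ∈ (L.dom k).filter (fun Y => C.scale Y = j), Real.exp (-(κ * C.d Y)) * ‖ρ e (L.vec g U k Y)‖ ≤
      M.rHist k * (c * ω ^ (k - 1 - j))

/-- HYPOTHESIS SHAPE `VecBudgetLoc L W κ V ρ` — the total weighted budget of the step-`k` insertion vectors PER READ-OUT (`B13Base.VecBudget`
localized; a consequence of `AgeBudgetLoc`, `vecBudgetLoc_of_ageBudgetLoc`). [folklore] -/
def VecBudgetLoc (L : LinearInsertion C Hist) (W : Set (ℕ → ℝ)) (κ : ℝ) (V : ℕ → ℝ) (ρ : E → (Hist →L[ℂ] ℂ)) : Prop :=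
  ∀ k, ∀ g ∈ W, ∀ (U : C.BgB) (e : E), ∑ Y ∈ L.dom k, Real.exp (-(κ * C.d Y)) * ‖ρ e (L.vec g U k Y)‖ ≤ V k

/-- HYPOTHESIS SHAPE `VecRateLoc LA LB M W κ δv θ ρ` — the two-spacing rate of the insertion vectors PER READ-OUT
(`InsertionLinearRate.VecRate` localized; NE2-TYPE, NOT PRINTED, displayed). [folklore] -/
def VecRateLoc (LA LB : LinearInsertion C Hist) (M : StepModel C Op Hist) (W : Set (ℕ → ℝ)) (κ δv θ : ℝ)
    (ρ : E → (Hist →L[ℂ] ℂ)) : Prop :=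
  ∀ k, ∀ g ∈ W, ∀ (U : C.BgB) (e : E),
    ∑ Y ∈ LA.dom k, Real.exp (-(κ * C.d Y)) * ‖ρ e (LA.vec g U k Y - LB.vec g U k Y)‖ ≤ δv * θ ^ k * M.rHist k

variable {L LA LB : LinearInsertion C Hist} {M : StepModel C Op Hist} {W : Set (ℕ → ℝ)} {ρ : E → (Hist →L[ℂ] ℂ)}

omit [NormedSpace ℂ Op] in
/-- A weighted sum of read-out moduli is at most the weighted sum of norms when the read-outs have norm `≤ 1`. [folklore] -/
theorem sum_readout_le_sum_norm (hρ1 : ∀ e (h : Hist), ‖ρ e h‖ ≤ ‖h‖) {κ : ℝ} (s : Finset C.Dom) (v : C.Dom → Hist) (e : E) :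
    ∑ Y ∈ s, Real.exp (-(κ * C.d Y)) * ‖ρ e (v Y)‖ ≤ ∑ Y ∈ s, Real.exp (-(κ * C.d Y)) * ‖v Y‖ :=
  Finset.sum_le_sum fun Y _ => mul_le_mul_of_nonneg_left (hρ1 e (v Y)) (Real.exp_pos _).le

/-- BRIDGE: the global age budget implies the per-read-out one along read-outs of norm `≤ 1`. [folklore] -/
theorem ageBudgetLoc_of_ageBudget (hρ1 : ∀ e (h : Hist), ‖ρ e h‖ ≤ ‖h‖) {κ c ω : ℝ} (hb : AgeBudget L M W κ c ω) :
    AgeBudgetLoc L M W κ c ω ρ := fun k g hg U j hj e =>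
  (sum_readout_le_sum_norm hρ1 _ _ e).trans (hb k g hg U j hj)

omit [NormedAddCommGroup Op] [NormedSpace ℂ Op] in
/-- BRIDGE: the global total budget implies the per-read-out one along read-outs of norm `≤ 1`. [folklore] -/
theorem vecBudgetLoc_of_vecBudget (hρ1 : ∀ e (h : Hist), ‖ρ e h‖ ≤ ‖h‖) {κ : ℝ} {V : ℕ → ℝ} (hv : VecBudget L W κ V) :
    VecBudgetLoc L W κ V ρ := fun k g hg U e =>
  (sum_readout_le_sum_norm hρ1 _ _ e).trans (hv k g hg U)

/-- BRIDGE: the global vector rate implies the per-read-out one along read-outs of norm `≤ 1`. [folklore] -/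
theorem vecRateLoc_of_vecRate (hρ1 : ∀ e (h : Hist), ‖ρ e h‖ ≤ ‖h‖) {κ δv θ : ℝ} (hv : VecRate LA LB M W κ δv θ) :
    VecRateLoc LA LB M W κ δv θ ρ := fun k g hg U e =>
  (sum_readout_le_sum_norm hρ1 _ (fun Y => LA.vec g U k Y - LB.vec g U k Y) e).trans (hv k g hg U)

end Shapes

/-! ## §3 The consumers re-proved along a norming family: W3, the total, the (1.36) mechanism (leaf L03 ∕ `BaseBudget`), W4 -/

section Consumers

variable {L LA LB : LinearInsertion C Hist} {M : StepModel C Op Hist} {W : Set (ℕ → ℝ)} {ρ : E → (Hist →L[ℂ] ℂ)}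

/-- **W3 AT AN ARBITRARY LEVEL FROM THE PER-READ-OUT AGE BUDGET**: `Norming ρ ∧ Reads ∧ AgeBudgetLoc κ c ω ρ ∧ 0 ≤ c ∧ 0 ≤ ω ⟹
M.InsScaleBoundLevel W κ c ω` — for each read-out the table entries of the other scales vanish, those of scale `j` are `≤ T·e^{−κd}`, and
the per-read-out budget closes; then `Norming`. [folklore] -/
theorem insScaleBoundLevel_of_ageBudgetLoc (hρ : Norming ρ) {κ c ω : ℝ} (h : Reads L M W) (hb : AgeBudgetLoc L M W κ c ω ρ)
    (hc : 0 ≤ c) (hω : 0 ≤ ω) : M.InsScaleBoundLevel W κ c ω := by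
  intro k g hg U t j T hj hT hsupp hbd
  rw [h k g hg U t, h k g hg U 0, L.ins_sub_ins_zero]
  have hμ : 0 ≤ M.rHist k * (c * (ω ^ (k - 1 - j) * T)) :=
    mul_nonneg (M.rHist_pos k).le (mul_nonneg hc (mul_nonneg (pow_nonneg hω _) hT))
  refine norm_sum_smul_le_of_norming hρ hμ fun e => ?_
  have hsplit : ∑ Y ∈ L.dom k, |t Y| * ‖ρ e (L.vec g U k Y)‖ =
      ∑ Y ∈ (L.dom k).filter (fun Y => C.scale Y = j), |t Y| * ‖ρ e (L.vec g U k Y)‖ := by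
    rw [Finset.sum_filter]
    refine Finset.sum_congr rfl fun Y _ => ?_
    by_cases hY : C.scale Y = j
    · simp [hY]
    · simp [hsupp Y hY, hY]
  rw [hsplit]
  calc ∑ Y ∈ (L.dom k).filter (fun Y => C.scale Y = j), |t Y| * ‖ρ e (L.vec g U k Y)‖
      ≤ ∑ Y ∈ (L.dom k).filter (fun Y => C.scale Y = j), T * (Real.exp (-(κ * C.d Y)) * ‖ρ e (L.vec g U k Y)‖) := by
        refine Finset.sum_le_sum fun Y hY => ?_
        rw [Finset.mem_filter] at hY
        calc |t Y| * ‖ρ e (L.vec g U k Y)‖ ≤ T * Real.exp (-(κ * C.d Y)) * ‖ρ e (L.vec g U k Y)‖ :=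
              mul_le_mul_of_nonneg_right (hbd Y hY.2) (norm_nonneg _)
          _ = T * (Real.exp (-(κ * C.d Y)) * ‖ρ e (L.vec g U k Y)‖) := by ring
    _ = T * ∑ Y ∈ (L.dom k).filter (fun Y => C.scale Y = j), Real.exp (-(κ * C.d Y)) * ‖ρ e (L.vec g U k Y)‖ := by
        rw [Finset.mul_sum]
    _ ≤ T * (M.rHist k * (c * ω ^ (k - 1 - j))) := mul_le_mul_of_nonneg_left (hb k g hg U j hj e) hT
    _ = M.rHist k * (c * (ω ^ (k - 1 - j) * T)) := by ring

/-- **W3 AT THE REFERENCE LEVEL `E₁ ≥ 0` from the per-read-out age budget**: ⟹ `M.InsScaleBound W κ E₁ c ω` BY NAME. [folklore] -/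
theorem insScaleBound_of_ageBudgetLoc (hρ : Norming ρ) {κ E₁ c ω : ℝ} (h : Reads L M W) (hb : AgeBudgetLoc L M W κ c ω ρ)
    (hc : 0 ≤ c) (hω : 0 ≤ ω) (hE₁ : 0 ≤ E₁) : M.InsScaleBound W κ E₁ c ω :=
  fun k g hg U t j hj hsupp hbd => insScaleBoundLevel_of_ageBudgetLoc hρ h hb hc hω k g hg U t j E₁ hj hE₁ hsupp hbd

/-- **The four insertion binders of the END faces from the reading and ONE per-read-out one-run budget** (`InsAffine`, `InsBlind`,
`InsHomog` by construction as in the class file; `InsScaleBound` by §3). [folklore] -/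
theorem insertion_binders_of_reads_loc (hρ : Norming ρ) {κ E₁ c ω : ℝ} (h : Reads L M W) (hb : AgeBudgetLoc L M W κ c ω ρ)
    (hc : 0 ≤ c) (hω : 0 ≤ ω) (hE₁ : 0 ≤ E₁) :
    M.InsAffine W ∧ M.InsBlind W ∧ M.InsHomog W ∧ M.InsScaleBound W κ E₁ c ω :=
  ⟨LinearInsertion.insAffine_of_reads h, LinearInsertion.insBlind_of_reads h, LinearInsertion.insHomog_of_reads h,
    insScaleBound_of_ageBudgetLoc hρ h hb hc hω hE₁⟩

/-- **THE PER-READ-OUT TOTAL FROM THE PER-READ-OUT AGE BUDGET**: `AgeBudgetLoc κ c ω ρ ∧ 0 ≤ c ∧ 0 ≤ ω < 1 ⟹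
VecBudgetLoc (k ↦ rHist k·c/(1 − ω)) ρ` — split by scale, geometric sum, for each read-out (`B13Base.vecBudget_of_ageBudget` localized).
[folklore] -/
theorem vecBudgetLoc_of_ageBudgetLoc {κ c ω : ℝ} (hb : AgeBudgetLoc L M W κ c ω ρ) (hc : 0 ≤ c) (hω : 0 ≤ ω) (hω1 : ω < 1) :
    VecBudgetLoc L W κ (fun k => M.rHist k * (c / (1 - ω))) ρ := by
  intro k g hg U e
  have hmaps : ∀ Y ∈ L.dom k, C.scale Y ∈ range k := fun Y hY => mem_range.2 (L.dom_lt k Y hY)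
  rw [← sum_fiberwise_of_maps_to hmaps]
  have hstep : ∀ j ∈ range k,
      ∑ Y ∈ (L.dom k).filter (fun Y => C.scale Y = j), Real.exp (-(κ * C.d Y)) * ‖ρ e (L.vec g U k Y)‖ ≤
        M.rHist k * (c * ω ^ (k - 1 - j)) := fun j hj => hb k g hg U j (mem_range.1 hj) e
  calc ∑ j ∈ range k, ∑ Y ∈ (L.dom k).filter (fun Y => C.scale Y = j), Real.exp (-(κ * C.d Y)) * ‖ρ e (L.vec g U k Y)‖
      ≤ ∑ j ∈ range k, M.rHist k * (c * ω ^ (k - 1 - j)) := sum_le_sum hstep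
    _ = M.rHist k * (c * ∑ j ∈ range k, ω ^ (k - 1 - j)) := by rw [mul_sum, mul_sum]
    _ ≤ M.rHist k * (c * (1 / (1 - ω))) :=
        mul_le_mul_of_nonneg_left (mul_le_mul_of_nonneg_left (sum_pow_age_pred_le hω hω1 k) hc) (M.rHist_pos k).le
    _ = M.rHist k * (c / (1 - ω)) := by rw [mul_one_div]

omit [NormedAddCommGroup Op] [NormedSpace ℂ Op] in
/-- **A TABLE OF ONE-RUN LEVEL `T ≥ 0` MOVES THE INSERTED HISTORY OFF ITS BASE PART BY AT MOST `T·V k`** when the per-read-out total is `V k ≥ 0`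
(the (1.36) mechanism of [II] Lemma 1∕2, localized: PER ENTRY of the potential table, the level of the earlier actions times the local
budget of the localisation vectors; then `Norming`). [folklore] -/
theorem norm_ins_sub_base_le_of_vecBudgetLoc (hρ : Norming ρ) {κ T : ℝ} {V : ℕ → ℝ} (hv : VecBudgetLoc L W κ V ρ) (hT : 0 ≤ T)
    {k : ℕ} (hV : 0 ≤ V k) {g : ℕ → ℝ} (hg : g ∈ W) (U : C.BgB) {t : C.Dom → ℝ}
    (ht : ∀ Y ∈ L.dom k, |t Y| ≤ T * Real.exp (-(κ * C.d Y))) : ‖L.ins g U k t - L.base g U k‖ ≤ T * V k := by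
  rw [LinearInsertion.ins, add_sub_cancel_left]
  refine norm_sum_smul_le_of_norming hρ (mul_nonneg hT hV) fun e => ?_
  calc ∑ Y ∈ L.dom k, |t Y| * ‖ρ e (L.vec g U k Y)‖
      ≤ ∑ Y ∈ L.dom k, T * (Real.exp (-(κ * C.d Y)) * ‖ρ e (L.vec g U k Y)‖) := by
        refine Finset.sum_le_sum fun Y hY => ?_
        calc |t Y| * ‖ρ e (L.vec g U k Y)‖ ≤ T * Real.exp (-(κ * C.d Y)) * ‖ρ e (L.vec g U k Y)‖ :=
              mul_le_mul_of_nonneg_right (ht Y hY) (norm_nonneg _)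
          _ = T * (Real.exp (-(κ * C.d Y)) * ‖ρ e (L.vec g U k Y)‖) := by ring
    _ = T * ∑ Y ∈ L.dom k, Real.exp (-(κ * C.d Y)) * ‖ρ e (L.vec g U k Y)‖ := by rw [Finset.mul_sum]
    _ ≤ T * V k := mul_le_mul_of_nonneg_left (hv k g hg U e) hT

/-- **RUN B'S HISTORY BUDGET FROM THE PRINTED ONE-RUN LEVEL (leaf L06) THROUGH THE LINEAR CLASS, LOCALIZED**: `ReadsB`, the per-read-out
total `VecBudgetLoc LB W κ V ρ` (`V ≥ 0`), `DecayBound EB W E₀ κ`, `0 ≤ E₀`, centre history component = the base part ⟹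
`HistBudgetB M EB W ctr (k ↦ E₀·V k)` BY NAME (`B13Base.histBudgetB_of_linear` localized). [folklore] -/
theorem histBudgetB_of_linearLoc (hρ : Norming ρ) {EB : Functional C C.BgB} {ctr : ℕ → (ℕ → ℝ) → C.BgB → Op × Hist} {κ E₀ : ℝ}
    {V : ℕ → ℝ} (hB : ReadsB LB M W) (hv : VecBudgetLoc LB W κ V ρ) (hV : ∀ k, 0 ≤ V k) (hdB : DecayBound EB W E₀ κ)
    (hE₀ : 0 ≤ E₀) (hctr : ∀ k (g : ℕ → ℝ) (U : C.BgB), (ctr k g U).2 = LB.base g U k) :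
    HistBudgetB M EB W ctr fun k => E₀ * V k := by
  intro k g hg U
  change ‖M.insB g U k (tableB EB g U) - (ctr k g U).2‖ ≤ E₀ * V k
  rw [hB k g hg U, hctr k g U]
  exact norm_ins_sub_base_le_of_vecBudgetLoc hρ hv hE₀ (hV k) hg U fun Y _ => hdB g hg U Y

/-- **THE A-TWIN, LOCALIZED** (feeds the secant face's `HistBudgetA` BY NAME): run A's linear reading with per-read-out total `VA ≥ 0`,
`DecayBound EA W EA₀ κ` (leaf L05), the displayed NE2-TYPE `BaseRate LA LB M W δb θ`, centre history component = run B's base part ⟹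
`HistBudgetA M ctr EA W (k ↦ δb·θ^k·rHist k + EA₀·VA k)`. [folklore] -/
theorem histBudgetA_of_linearLoc (hρ : Norming ρ) {EA : Functional C C.BgA} {ctr : ℕ → (ℕ → ℝ) → C.BgB → Op × Hist}
    {κ EA₀ δb θ : ℝ} {VA : ℕ → ℝ} (hA : Reads LA M W) (hv : VecBudgetLoc LA W κ VA ρ) (hVA : ∀ k, 0 ≤ VA k)
    (hdA : DecayBound EA W EA₀ κ) (hEA₀ : 0 ≤ EA₀) (hbr : BaseRate LA LB M W δb θ)
    (hctr : ∀ k (g : ℕ → ℝ) (U : C.BgB), (ctr k g U).2 = LB.base g U k) :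
    HistBudgetA M ctr EA W fun k => δb * θ ^ k * M.rHist k + EA₀ * VA k := by
  intro k g hg U
  change ‖M.insA g U k (tableA EA g U) - (ctr k g U).2‖ ≤ δb * θ ^ k * M.rHist k + EA₀ * VA k
  rw [hA k g hg U, hctr k g U]
  calc ‖LA.ins g U k (tableA EA g U) - LB.base g U k‖
      ≤ ‖LA.ins g U k (tableA EA g U) - LA.base g U k‖ + ‖LA.base g U k - LB.base g U k‖ :=
        norm_sub_le_norm_sub_add_norm_sub _ _ _
    _ ≤ EA₀ * VA k + δb * θ ^ k * M.rHist k :=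
        add_le_add (norm_ins_sub_base_le_of_vecBudgetLoc hρ hv hEA₀ (hVA k) hg U fun Y _ => hdA g hg (C.transport U) Y)
          (hbr k g hg U)
    _ = δb * θ ^ k * M.rHist k + EA₀ * VA k := add_comm _ _

/-- **LEAF L03 FROM DISPLAYED ONE-RUN INPUTS, LOCALIZED**: budget-box base with centre history component `LB.base`, operators within budget,
run B's linear reading with per-read-out total `V ≥ 0`, run B's level (L06), `E₀·V k ≤ BHist k` ⟹ `M.InBase EB W` (`B13Base.inBase_of_linear`
localized). [folklore] -/
theorem inBase_of_linearLoc (hρ : Norming ρ) {ctr : ℕ → (ℕ → ℝ) → C.BgB → Op × Hist} {BOp BHist : ℕ → ℝ}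
    (h : HasBudgetBase M ctr BOp BHist) {EB : Functional C C.BgB} {κ E₀ : ℝ} {V : ℕ → ℝ} (hop : OpBudgetB M W ctr BOp)
    (hB : ReadsB LB M W) (hv : VecBudgetLoc LB W κ V ρ) (hV : ∀ k, 0 ≤ V k) (hdB : DecayBound EB W E₀ κ) (hE₀ : 0 ≤ E₀)
    (hctr : ∀ k (g : ℕ → ℝ) (U : C.BgB), (ctr k g U).2 = LB.base g U k) (hBH : ∀ k, E₀ * V k ≤ BHist k) : M.InBase EB W :=
  inBase_of_budgets h hop (histBudgetB_mono (histBudgetB_of_linearLoc hρ hB hv hV hdB hE₀ hctr) hBH)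

/-- **THE SELF-CENTRED, LOCALLY AGE-BUDGETED INSTANCE**: install `selfBudgetBase M LB E₀ c ω`; from run B's linear reading `ReadsB`, ITS
PER-READ-OUT age budget `AgeBudgetLoc LB M W κ c ω ρ` along a norming family, the printed level `DecayBound EB W E₀ κ` (L06) and the signs,
BOTH `InBase` (L03) and `BaseBudget` hold for the installed model (`B13Base.inBase_baseBudget_of_selfCtr_ageBudget` localized; every other
END-face binder transfers from `M` unchanged, `B13Base.withBase_binders`). [folklore] -/
theorem inBase_baseBudget_of_selfCtr_ageBudgetLoc (hρ : Norming ρ) {EB : Functional C C.BgB} {κ E₀ c ω : ℝ}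
    (hB : ReadsB LB M W) (hb : AgeBudgetLoc LB M W κ c ω ρ) (hdB : DecayBound EB W E₀ κ) (hE₀ : 0 ≤ E₀) (hc : 0 ≤ c)
    (hω : 0 ≤ ω) (hω1 : ω < 1) :
    (M.withBase (selfBudgetBase M LB E₀ c ω)).InBase EB W ∧
      BaseBudget (M.withBase (selfBudgetBase M LB E₀ c ω)) W (selfCtr M LB.base) 0
        fun k => E₀ * (M.rHist k * (c / (1 - ω))) := by
  have h : HasBudgetBase (M.withBase (selfBudgetBase M LB E₀ c ω)) (selfCtr M LB.base) 0
      fun k => E₀ * (M.rHist k * (c / (1 - ω))) :=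
    hasBudgetBase_withBase M _ _ _
  have hv : VecBudgetLoc LB W κ (fun k => M.rHist k * (c / (1 - ω))) ρ := vecBudgetLoc_of_ageBudgetLoc hb hc hω hω1
  have hV : ∀ k, 0 ≤ M.rHist k * (c / (1 - ω)) := fun k =>
    mul_nonneg (M.rHist_pos k).le (div_nonneg hc (by linarith))
  exact ⟨inBase_of_linearLoc hρ h (opBudgetB_selfCtr _ LB.base W) hB hv hV hdB hE₀ (fun _ _ _ => rfl) fun _ => le_rfl,
    baseBudget_of_hasBudgetBase h W⟩

/-- **W4 WITHOUT ANALYTICITY for the linear class, LOCALIZED**: `Norming ρ ∧ Reads ∧ ReadsB ∧ (common domains) ∧ BaseRate δb θ ∧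
VecRateLoc κ δv θ ρ ∧ 0 ≤ E₀, δv, θ ⟹ M.InsertionRate W κ E₀ (δb + E₀·δv) θ` BY NAME (`InsertionLinearRate.insertionRate_of_linear` with the
localized triangle inequality). [folklore] -/
theorem insertionRate_of_linearLoc (hρ : Norming ρ) {κ E₀ δb δv θ : ℝ} (hA : Reads LA M W) (hB : ReadsB LB M W)
    (hdom : ∀ k, LA.dom k = LB.dom k) (hbase : BaseRate LA LB M W δb θ) (hvec : VecRateLoc LA LB M W κ δv θ ρ) (hE₀ : 0 ≤ E₀)
    (hδv : 0 ≤ δv) (hθ : 0 ≤ θ) : M.InsertionRate W κ E₀ (δb + E₀ * δv) θ := by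
  intro k g hg U t ht
  rw [hA k g hg U t, hB k g hg U t, InsertionLinearRate.LinearPair.ins_sub_ins hdom]
  have hμ : 0 ≤ E₀ * (δv * θ ^ k * M.rHist k) :=
    mul_nonneg hE₀ (mul_nonneg (mul_nonneg hδv (pow_nonneg hθ _)) (M.rHist_pos k).le)
  have hsum : ‖∑ Y ∈ LA.dom k, ((t Y : ℝ) : ℂ) • (LA.vec g U k Y - LB.vec g U k Y)‖ ≤ E₀ * (δv * θ ^ k * M.rHist k) := by
    refine norm_sum_smul_le_of_norming hρ hμ fun e => ?_
    calc ∑ Y ∈ LA.dom k, |t Y| * ‖ρ e (LA.vec g U k Y - LB.vec g U k Y)‖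
        ≤ ∑ Y ∈ LA.dom k, E₀ * (Real.exp (-(κ * C.d Y)) * ‖ρ e (LA.vec g U k Y - LB.vec g U k Y)‖) := by
          refine Finset.sum_le_sum fun Y _ => ?_
          calc |t Y| * ‖ρ e (LA.vec g U k Y - LB.vec g U k Y)‖
              ≤ E₀ * Real.exp (-(κ * C.d Y)) * ‖ρ e (LA.vec g U k Y - LB.vec g U k Y)‖ :=
                mul_le_mul_of_nonneg_right (ht Y) (norm_nonneg _)
            _ = E₀ * (Real.exp (-(κ * C.d Y)) * ‖ρ e (LA.vec g U k Y - LB.vec g U k Y)‖) := by ring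
      _ = E₀ * ∑ Y ∈ LA.dom k, Real.exp (-(κ * C.d Y)) * ‖ρ e (LA.vec g U k Y - LB.vec g U k Y)‖ := by rw [Finset.mul_sum]
      _ ≤ E₀ * (δv * θ ^ k * M.rHist k) := mul_le_mul_of_nonneg_left (hvec k g hg U e) hE₀
  calc ‖(LA.base g U k - LB.base g U k) + ∑ Y ∈ LA.dom k, ((t Y : ℝ) : ℂ) • (LA.vec g U k Y - LB.vec g U k Y)‖
      ≤ ‖LA.base g U k - LB.base g U k‖ + ‖∑ Y ∈ LA.dom k, ((t Y : ℝ) : ℂ) • (LA.vec g U k Y - LB.vec g U k Y)‖ :=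
        norm_add_le _ _
    _ ≤ δb * θ ^ k * M.rHist k + E₀ * (δv * θ ^ k * M.rHist k) := add_le_add (hbase k g hg U) hsum
    _ = (δb + E₀ * δv) * θ ^ k * M.rHist k := by ring

end Consumers

end Summit.QuantumFields.BalabanUV.T4Continuum.InsertionLinearClassLoc

end
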